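import Mathlib
import Summits.Ventures.PercRepro2.SwOutMixedArmsCount
import Summits.Ventures.PercRepro2.SwOutMixedArmsOverlap

/-!
# The several-arms big-block lemma on the face `f = ⊥` (blind cell PercRepro2, night-4 g20,
2026-08-27; proofs/NIGHT4-G20.md §4)

**Theorem** `face_empty_card_le`: for every lower set `Q` with `G5` lying on the face `f = ⊥`
(with at least one u-arm) and every up-set `𝓔`, the non-leaking part of `Q` satisfies the rigid
counting inequality with the blue sets taken relative to the face.  The pieces `SA` (core) and
`SB A` (the slab piece of `A`) and the two global cases are described in
`SwOutMixedArmsOverlap`; here: the pieces, the partition of the count (`card_split`), the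
lowerness of every piece, the pair cancellation, and the assembly.
-/

namespace Summit.Ventures.PercRepro2

namespace MixedArms

open scoped Classical

variable {ι ρ ν κ : Type*}

section Pieces

variable [Nonempty ι] [Fintype ι] [DecidableEq ι] [Fintype ρ] [DecidableEq ρ] [Fintype ν]
  [DecidableEq ν] [Fintype κ] [DecidableEq κ] (arm : ν → ρ) (Q : Set (PtR ι ρ ν κ))

/-- The core piece: the core points of `Q`; when `F(⊥, ⊤) ∉ Q`, without the `s = ⊤` slice. -/
noncomputable def SA : Finset (PtR ι ρ ν κ) :=
  Finset.univ.filter fun p => p ∈ Q ∧ Core p arm ∧ (bPt ∈ Q ∨ p.1 ≠ fun _ => true)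

/-- The slab points of `Q` of index `A`. -/
noncomputable def STBA (A : Finset ρ) : Finset (PtR ι ρ ν κ) :=
  Finset.univ.filter fun p => p ∈ Q ∧ (TSlab p arm ∨ BSlab p arm) ∧ idxA p = A

/-- The slab piece of `A`: the slab points of index `A` without `obPt A`, and without `oPt A` when
`F(⊥, ⊤) ∈ Q`. -/
noncomputable def SB (A : Finset ρ) : Finset (PtR ι ρ ν κ) :=
  (STBA arm Q A).filter fun p => p ≠ obPt arm A ∧ (bPt ∈ Q → p ≠ oPt arm A)

variable {arm Q}

omit [Nonempty ι] in
/-- Membership in the core piece. -/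
lemma mem_SA {p : PtR ι ρ ν κ} :
    p ∈ SA arm Q ↔ p ∈ Q ∧ Core p arm ∧ (bPt ∈ Q ∨ p.1 ≠ fun _ => true) := by
  simp only [SA, Finset.mem_filter, Finset.mem_univ, true_and]

/-- Membership in the slab points of index `A`. -/
lemma mem_STBA {A : Finset ρ} {p : PtR ι ρ ν κ} :
    p ∈ STBA arm Q A ↔ p ∈ Q ∧ (TSlab p arm ∨ BSlab p arm) ∧ idxA p = A := by
  simp only [STBA, Finset.mem_filter, Finset.mem_univ, true_and]

/-- Membership in the slab piece of `A`. -/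
lemma mem_SB {A : Finset ρ} {p : PtR ι ρ ν κ} :
    p ∈ SB arm Q A ↔ (p ∈ Q ∧ (TSlab p arm ∨ BSlab p arm) ∧ idxA p = A) ∧
      (p ≠ obPt arm A ∧ (bPt ∈ Q → p ≠ oPt arm A)) := by
  simp only [SB, Finset.mem_filter, mem_STBA]

/-- The slab pieces are pairwise disjoint. -/
lemma disjoint_SB {A A' : Finset ρ} (h : A ≠ A') (R : PtR ι ρ ν κ → Prop) :
    Disjoint ((SB arm Q A).filter R) ((SB arm Q A').filter R) := by
  rw [Finset.disjoint_left]
  intro p hp hp'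
  rw [Finset.mem_filter, mem_SB] at hp hp'
  exact h (hp.1.1.2.2.symm.trans hp'.1.1.2.2)

/-- The core piece and the slab pieces are disjoint. -/
lemma disjoint_SA_SB (hf : Q ⊆ face ∅) (A : Finset ρ) (R : PtR ι ρ ν κ → Prop) :
    Disjoint ((SA arm Q).filter R) ((SB arm Q A).filter R) := by
  rw [Finset.disjoint_left]
  intro p hp hp'
  rw [Finset.mem_filter, mem_SA] at hp
  rw [Finset.mem_filter, mem_SB] at hp'
  obtain ⟨⟨hQ, hc, hcase⟩, -⟩ := hp
  obtain ⟨⟨⟨-, hs, hA⟩, hne, hne'⟩, -⟩ := hp'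
  rcases hs with ⟨hT, -⟩ | ⟨hB, -⟩
  · -- `p = oPt A`
    have := eq_oPt_of_core_top hc hT (hf hQ)
    rw [hA] at this
    rcases hcase with hb | hT'
    · exact hne' hb this
    · exact hT' hT
  · have := eq_obPt_of_core_bot hc hB (hf hQ)
    rw [hA] at this
    exact hne this

/-- Every non-leaking point of `Q` on the face lies in the core piece or in a slab piece. -/
lemma mem_SA_or_SB {p : PtR ι ρ ν κ} (hQ : p ∈ Q) (hL : ¬ Leak p arm) :
    p ∈ SA arm Q ∨ p ∈ SB arm Q (idxA p) := by
  by_cases hc : Core p arm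
  · by_cases hcase : bPt ∈ Q ∨ p.1 ≠ fun _ => true
    · exact Or.inl (mem_SA.2 ⟨hQ, hc, hcase⟩)
    · -- `F(⊥, ⊤) ∉ Q` and `p = oPt (idxA p)`: counted in the slab piece
      have hb : (bPt : PtR ι ρ ν κ) ∉ Q := fun h => hcase (Or.inl h)
      have hT : p.1 = fun _ => true := by
        by_contra h
        exact hcase (Or.inr h)
      right
      rw [mem_SB]
      refine ⟨⟨hQ, Or.inl (tslab_of_core_top hc hT), rfl⟩, ?_, fun hb' => absurd hb' hb⟩
      intro h
      have := congrArg (fun q : PtR ι ρ ν κ => q.1 (Classical.arbitrary ι)) h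
      simp only [hT, obPt_fst] at this
      exact absurd this (by decide)
  · right
    rw [mem_SB]
    have hs : TSlab p arm ∨ BSlab p arm := by
      rcases (not_leak_iff arm p).1 hL with h | h
      · exact absurd h hc
      · exact h
    refine ⟨⟨hQ, hs, rfl⟩, fun h => hc (h ▸ core_obPt), fun _ h => hc (h ▸ core_oPt)⟩

/-- A count over the non-leaking points of `Q` splits into the core piece and the slab pieces. -/
lemma card_split (hf : Q ⊆ face ∅) (R : PtR ι ρ ν κ → Prop) :
    (Finset.univ.filter fun p : PtR ι ρ ν κ => p ∈ Q ∧ ¬ Leak p arm ∧ R p).card =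
      ((SA arm Q).filter R).card + ∑ A : Finset ρ, ((SB arm Q A).filter R).card := by
  rw [← Finset.card_biUnion (fun A _ A' _ h => disjoint_SB h R),
    ← Finset.card_union_of_disjoint]
  · congr 1
    ext p
    simp only [Finset.mem_filter, Finset.mem_univ, true_and, Finset.mem_union, Finset.mem_biUnion]
    constructor
    · rintro ⟨hQ, hL, hR⟩
      rcases mem_SA_or_SB hQ hL with h | h
      · exact Or.inl ⟨h, hR⟩
      · exact Or.inr ⟨idxA p, h, hR⟩
    · rintro (⟨h, hR⟩ | ⟨A, h, hR⟩)
      · rw [mem_SA] at h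
        exact ⟨h.1, not_leak_of_core arm h.2.1, hR⟩
      · rw [mem_SB] at h
        refine ⟨h.1.1, ?_, hR⟩
        rcases h.1.2.1 with hs | hs
        · exact not_leak_of_tslab arm hs
        · exact not_leak_of_bslab arm hs
  · rw [Finset.disjoint_left]
    intro p hp hp'
    rw [Finset.mem_biUnion] at hp'
    obtain ⟨A, -, hp'⟩ := hp'
    exact Finset.disjoint_left.1 (disjoint_SA_SB hf A R) hp hp'

end Pieces

section PieceProofs

variable [Nonempty ι] [Fintype ι] [DecidableEq ι] [Fintype ρ] [DecidableEq ρ] [Fintype ν]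
  [DecidableEq ν] [Fintype κ] [DecidableEq κ] {arm : ν → ρ} {Q : Set (PtR ι ρ ν κ)}

omit [Nonempty ι] in
/-- The core projection is injective on the core piece. -/
lemma injOn_projC (hf : Q ⊆ face ∅) : Set.InjOn projC (SA arm Q : Set (PtR ι ρ ν κ)) := by
  intro p hp q hq h
  rw [Finset.mem_coe, mem_SA] at hp hq
  rw [← coreR_projC hp.2.1 (hf hp.1), ← coreR_projC hq.2.1 (hf hq.1), h]

omit [Nonempty ι] in
/-- The red set of a core piece point is read off the core cube. -/
lemma ER_eq_coreR_projC (hf : Q ⊆ face ∅) {p : PtR ι ρ ν κ} (hp : p ∈ SA arm Q) :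
    ER p = ER (coreR arm (projC p)) := by
  rw [mem_SA] at hp
  rw [coreR_projC hp.2.1 (hf hp.1)]

omit [Nonempty ι] in
/-- The relative blue set of a core piece point is read off the flipped core cube. -/
lemma EBT_eq_coreR_projC (hf : Q ⊆ face ∅) {p : PtR ι ρ ν κ} (hp : p ∈ SA arm Q) :
    EBT ∅ p = ER (coreR arm (flipAll (projC p))) := by
  rw [mem_SA] at hp
  have h := coreR_projC hp.2.1 (hf hp.1)
  conv_lhs => rw [← h]
  rw [EBT, flipT_empty_coreR]

omit [Nonempty ι] in
/-- The core piece is a lower set of the core cube. -/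
lemma isLowerSet_image_projC (hQ : IsLowerSet Q) (hf : Q ⊆ face ∅) :
    IsLowerSet (projC '' (SA arm Q : Set (PtR ι ρ ν κ))) := by
  rintro x' x hle ⟨p', hp', rfl⟩
  rw [Finset.mem_coe, mem_SA] at hp'
  have hp'eq := coreR_projC hp'.2.1 (hf hp'.1)
  refine ⟨coreR arm x, ?_, projC_coreR x⟩
  rw [Finset.mem_coe, mem_SA]
  have hxQ : (coreR arm x : PtR ι ρ ν κ) ∈ Q := by
    rw [← hp'eq] at hp'
    exact hQ (coreR_mono hle) hp'.1
  refine ⟨hxQ, core_coreR x, ?_⟩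
  rcases hp'.2.2 with hb | hT
  · exact Or.inl hb
  · right
    intro hx
    apply hT
    funext j
    have h1 : x (Sum.inl j) = true := congrFun hx j
    exact MixedPieces.true_le_imp (hle (Sum.inl j)) h1

variable {A : Finset ρ}

/-- A slab piece point is a slab point of `Q` of index `A`. -/
lemma mem_STBA_of_mem_SB {p : PtR ι ρ ν κ} (hp : p ∈ SB arm Q A) :
    p ∈ Q ∧ (TSlab p arm ∨ BSlab p arm) ∧ idxA p = A := (mem_SB.1 hp).1

/-- The slab projection is injective on the slab points of index `A`. -/
lemma injOn_projA_STBA (hf : Q ⊆ face ∅) :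
    Set.InjOn (projA arm A) (STBA arm Q A : Set (PtR ι ρ ν κ)) := by
  intro p hp q hq h
  rw [Finset.mem_coe, mem_STBA] at hp hq
  rw [← tbA_projA hp.2.1 (hf hp.1) hp.2.2, ← tbA_projA hq.2.1 (hf hq.1) hq.2.2, h]

/-- The slab projection is injective on the slab piece of `A`. -/
lemma injOn_projA_SB (hf : Q ⊆ face ∅) :
    Set.InjOn (projA arm A) (SB arm Q A : Set (PtR ι ρ ν κ)) :=
  (injOn_projA_STBA hf).mono (fun p hp => by
    rw [Finset.mem_coe] at hp ⊢
    exact Finset.mem_of_mem_filter p hp)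

omit [Fintype ι] [DecidableEq ι] [Fintype ν] [DecidableEq ν] [Fintype κ] [DecidableEq κ] in
/-- The red set of a slab point of index `A` is read off the slab cube of `A`. -/
lemma ER_eq_tbA_projA (hf : Q ⊆ face ∅) {p : PtR ι ρ ν κ}
    (hp : p ∈ Q ∧ (TSlab p arm ∨ BSlab p arm) ∧ idxA p = A) :
    ER p = ER (tbA arm A (projA arm A p)) := by
  rw [tbA_projA hp.2.1 (hf hp.1) hp.2.2]

omit [Fintype ι] [DecidableEq ι] [Fintype ν] [DecidableEq ν] [Fintype κ] in
/-- The relative blue set of a slab point of index `A` is read off the flipped slab cube. -/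
lemma EBT_eq_tbA_projA (hf : Q ⊆ face ∅) {p : PtR ι ρ ν κ}
    (hp : p ∈ Q ∧ (TSlab p arm ∨ BSlab p arm) ∧ idxA p = A) :
    EBT ∅ p = ER (tbA arm A (flipAll (projA arm A p))) := by
  have h := tbA_projA hp.2.1 (hf hp.1) hp.2.2
  conv_lhs => rw [← h]
  rw [EBT, flipT_empty_tbA]

/-- The slab points of index `A` form a lower set of the slab cube of `A`. -/
lemma isLowerSet_image_projA_STBA (hQ : IsLowerSet Q) (hG : G5 Q) (hf : Q ⊆ face ∅) :
    IsLowerSet (projA arm A '' (STBA arm Q A : Set (PtR ι ρ ν κ))) := by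
  rintro y' y hle ⟨p', hp', rfl⟩
  rw [Finset.mem_coe, mem_STBA] at hp'
  have hp'eq := tbA_projA hp'.2.1 (hf hp'.1) hp'.2.2
  refine ⟨tbA arm A y, ?_, projA_tbA y⟩
  rw [Finset.mem_coe, mem_STBA]
  exact ⟨tbA_mem_of_le hQ hG hle (by rw [hp'eq]; exact hp'.1), slab_tbA y, idxA_tbA y⟩

omit [Fintype ρ] [DecidableEq ρ] [Fintype ν] [DecidableEq ν] in
/-- A cube point above `projA (obPt A)` is `projA (obPt A)` or the top. -/
lemma eq_of_obPt_le {y' : Config (CubeA arm A)}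
    (hle : (Sum.elim (fun _ => false) (fun _ => true) : Config (CubeA arm A)) ≤ y') :
    y' = Sum.elim (fun _ => false) (fun _ => true) ∨ y' = fun _ => true := by
  cases h0 : y' (Sum.inl ())
  · left
    funext t
    rcases t with ⟨⟨⟩⟩ | t
    · exact h0
    · exact MixedPieces.true_le_imp (hle (Sum.inr t)) rfl
  · right
    funext t
    rcases t with ⟨⟨⟩⟩ | t
    · exact h0
    · exact MixedPieces.true_le_imp (hle (Sum.inr t)) rfl

/-- The slab piece of `A` is a lower set of the slab cube of `A` unless both `F(⊥, ⊤)` and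
`oPt A` lie in `Q`. -/
lemma isLowerSet_image_projA_SB (hQ : IsLowerSet Q) (hG : G5 Q) (hf : Q ⊆ face ∅)
    (hne : (bPt : PtR ι ρ ν κ) ∉ Q ∨ (oPt arm A : PtR ι ρ ν κ) ∉ Q) :
    IsLowerSet (projA arm A '' (SB arm Q A : Set (PtR ι ρ ν κ))) := by
  rintro y' y hle ⟨p', hp', rfl⟩
  rw [Finset.mem_coe, mem_SB] at hp'
  have hp'eq := tbA_projA hp'.1.2.1 (hf hp'.1.1) hp'.1.2.2
  have hyQ : (tbA arm A y : PtR ι ρ ν κ) ∈ Q :=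
    tbA_mem_of_le hQ hG hle (by rw [hp'eq]; exact hp'.1.1)
  refine ⟨tbA arm A y, ?_, projA_tbA y⟩
  rw [Finset.mem_coe, mem_SB]
  refine ⟨⟨hyQ, slab_tbA y, idxA_tbA y⟩, ?_, ?_⟩
  · intro hob
    -- `y = projA (obPt A)`: `p'` is `obPt A` (not in the piece) or the top (forces both points)
    have hy : y = Sum.elim (fun _ => false) (fun _ => true) := by
      have := congrArg (projA arm A) hob
      rwa [projA_tbA (ι := ι) (κ := κ), obPt, projA_tbA (ι := ι) (κ := κ)] at this
    rw [hy] at hle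
    rcases eq_of_obPt_le hle with h | h
    · apply hp'.2.1
      rw [← hp'eq, h]
      rfl
    · have ht : (tPt arm A : PtR ι ρ ν κ) ∈ Q := by
        rw [← hp'eq, h] at hp'
        exact hp'.1.1
      rcases hne with hb | ho
      · exact hb (bPt_mem_of_tPt_mem hQ hG ht)
      · exact ho (hQ oPt_le_tPt ht)
  · intro hb ho
    rcases hne with hb' | ho'
    · exact hb' hb
    · rw [ho] at hyQ
      exact ho' hyQ

omit [Fintype ι] [DecidableEq ι] [Fintype ρ] [Fintype ν] [DecidableEq ν] [Fintype κ] [DecidableEq κ] in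
/-- `oPt A` and `obPt A` differ. -/
lemma oPt_ne_obPt : (oPt arm A : PtR ι ρ ν κ) ≠ obPt arm A := by
  intro h
  have := congrArg (fun q : PtR ι ρ ν κ => q.1 (Classical.arbitrary ι)) h
  simp only [oPt_fst, obPt_fst] at this
  exact absurd this (by decide)

/-- When both overlap points of `A` lie in `Q`, the slab points of index `A` are the slab piece
plus the antipodal pair (counted). -/
lemma N_STBA_eq (hb : (bPt : PtR ι ρ ν κ) ∈ Q) (ho : (oPt arm A : PtR ι ρ ν κ) ∈ Q)
    (hQ : IsLowerSet Q) (R : PtR ι ρ ν κ → Prop) :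
    N (fun p => p ∈ STBA arm Q A ∧ R p) =
      N (fun p => p ∈ SB arm Q A ∧ R p) +
        N (fun p : PtR ι ρ ν κ => (p = oPt arm A ∨ p = obPt arm A) ∧ R p) := by
  have hob : (obPt arm A : PtR ι ρ ν κ) ∈ Q := hQ obPt_le_bPt hb
  rw [N_split_pred (fun p => p ∈ STBA arm Q A ∧ R p)
    (fun p => p = oPt arm A ∨ p = obPt arm A), add_comm]
  congr 1
  · apply N_congr
    intro p
    rw [mem_STBA, mem_SB]
    constructor
    · rintro ⟨⟨hp, hR⟩, hpair⟩
      exact ⟨⟨hp, fun h => hpair (Or.inr h), fun _ h => hpair (Or.inl h)⟩, hR⟩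
    · rintro ⟨⟨hp, h1, h2⟩, hR⟩
      exact ⟨⟨hp, hR⟩, fun h => h.elim (h2 hb) h1⟩
  · apply N_congr
    intro p
    rw [mem_STBA]
    constructor
    · rintro ⟨⟨hp, hR⟩, hpair⟩
      exact ⟨hpair, hR⟩
    · rintro ⟨hpair, hR⟩
      refine ⟨⟨?_, hR⟩, hpair⟩
      rcases hpair with rfl | rfl
      · exact ⟨ho, Or.inl (tslab_of_core_top core_oPt oPt_fst), idxA_oPt⟩
      · exact ⟨hob, Or.inr (bslab_of_core_bot core_obPt obPt_fst), idxA_obPt⟩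

/-- The red and blue hits of the antipodal pair agree. -/
lemma N_pair_ER_eq_EBT {𝓔 : Set (Set (AtomR ι ρ ν κ))} :
    N (fun p : PtR ι ρ ν κ => (p = oPt arm A ∨ p = obPt arm A) ∧ ER p ∈ 𝓔) =
      N (fun p : PtR ι ρ ν κ => (p = oPt arm A ∨ p = obPt arm A) ∧ EBT ∅ p ∈ 𝓔) := by
  rw [N_pair oPt_ne_obPt, N_pair oPt_ne_obPt]
  simp only [EBT, flipT_empty_oPt, flipT_empty_obPt]
  rw [add_comm]

/-- **The several-arms big-block lemma on the face `f = ⊥`**. -/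
theorem face_empty_card_le (hQ : IsLowerSet Q) (hG : G5 Q) (hf : Q ⊆ face ∅)
    {𝓔 : Set (Set (AtomR ι ρ ν κ))} (h𝓔 : IsUpperSet 𝓔) :
    (Finset.univ.filter fun p : PtR ι ρ ν κ => p ∈ Q ∧ ¬ Leak p arm ∧ ER p ∈ 𝓔).card ≤
      (Finset.univ.filter fun p : PtR ι ρ ν κ => p ∈ Q ∧ ¬ Leak p arm ∧ EBT ∅ p ∈ 𝓔).card := by
  have e1 := card_split (arm := arm) (Q := Q) hf (fun p => ER p ∈ 𝓔)
  have e2 := card_split (arm := arm) (Q := Q) hf (fun p => EBT ∅ p ∈ 𝓔)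
  beta_reduce at e1 e2
  rw [e1, e2]
  refine add_le_add ?_ (Finset.sum_le_sum fun A _ => ?_)
  · exact MixedPieces.card_le_of_embed ER (EBT ∅) (SA arm Q) projC (injOn_projC hf)
      (fun x => ER (coreR arm x)) (fun _ _ h => ER_coreR_mono h)
      (fun p hp => ER_eq_coreR_projC hf hp) (fun p hp => EBT_eq_coreR_projC hf hp)
      (isLowerSet_image_projC hQ hf) h𝓔
  · by_cases hne : (bPt : PtR ι ρ ν κ) ∉ Q ∨ (oPt arm A : PtR ι ρ ν κ) ∉ Q
    · exact MixedPieces.card_le_of_embed ER (EBT ∅) (SB arm Q A) (projA arm A)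
        (injOn_projA_SB hf) (fun y => ER (tbA arm A y)) (fun _ _ h => ER_tbA_mono h)
        (fun p hp => ER_eq_tbA_projA hf (mem_STBA_of_mem_SB hp))
        (fun p hp => EBT_eq_tbA_projA hf (mem_STBA_of_mem_SB hp))
        (isLowerSet_image_projA_SB hQ hG hf hne) h𝓔
    · have hb : (bPt : PtR ι ρ ν κ) ∈ Q := by
        by_contra h
        exact hne (Or.inl h)
      have ho : (oPt arm A : PtR ι ρ ν κ) ∈ Q := by
        by_contra h
        exact hne (Or.inr h)
      have key := MixedPieces.card_le_of_embed ER (EBT ∅) (STBA arm Q A) (projA arm A)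
        (injOn_projA_STBA hf) (fun y => ER (tbA arm A y)) (fun _ _ h => ER_tbA_mono h)
        (fun p hp => ER_eq_tbA_projA hf (mem_STBA.1 hp))
        (fun p hp => EBT_eq_tbA_projA hf (mem_STBA.1 hp))
        (isLowerSet_image_projA_STBA hQ hG hf) h𝓔
      rw [card_filter_eq_N, card_filter_eq_N, N_STBA_eq hb ho hQ, N_STBA_eq hb ho hQ,
        N_pair_ER_eq_EBT] at key
      rw [card_filter_eq_N, card_filter_eq_N]
      omega

end PieceProofs

end MixedArms

end Summit.Ventures.PercRepro2
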